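import Literature.MathematicalPhysics.QuantumFieldTheory.Balaban1983to89.B9B8KnitAveragingClosenessWeighted
import Literature.MathematicalPhysics.QuantumFieldTheory.Balaban1983to89.B9B8KnitColumnGauge
import Literature.MathematicalPhysics.QuantumFieldTheory.Balaban1983to89.B8Thm2TorusLettersPerOfKnit
import Literature.MathematicalPhysics.QuantumFieldTheory.Balaban1983to89.B9B8KnitLandauProjection

/-!
# `Balaban1983to89.B9B8KnitAveragingClosenessAtCorner` — the (B)-line bond junction, file F3: THE COLUMN HYPOTHESES (H1)–(H3) OF FILE c6 ∕ c7
# SUPPLIED AT THE CORNER-TREE TRANSPORTER FAMILY, AND `hQQ` PER BACKGROUND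

statement-level skeleton of published theorems with citation tags; proofs where landed; nothing here is a claim about the
Yang–Mills mass gap

Sub-row G-B8-T2S (unit `lit-balaban-t2s-1`, gen 8), RULING #10 road, crux (c′) (`g7/BLINE-DESIGN-g7.md` §4; ruling 2026-08-28 18:25Z: (F1) flatness →
(F2) corner gauge → (F3) torus junction at the corner family).  File c7 (`B9B8KnitAveragingClosenessWeighted.hQQ_of_columns`) turns three column-level
inequalities — (H1) the knit's column `LⁿQ_n(U₀)(X·δ_b)(ι)` is `Lⁿ·qK ι b·R(qT ι b)X` up to `δ₁‖X‖`, (H2) the knit's closed field `(−i)LⁿQ_n(U₀)(iηa♯)(ι)` is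
`ηLⁿ·(Q(U)a)(ι)` up to `δ₂‖a‖`, (H3) `‖(−i)LⁿQ_n(U₀)(iηa♯)(c)‖ ≤ C₃‖a‖` — into the displayed averaging hypothesis `hQQ` of the torus socket
(`B9B8KnitClosenessOfSectors.sockB9P3Per_torusIdx_of_sectors`, `…TorusSocketBetaZero.…₀`).  (H1)∕(H2) compare the knit's PARALLEL TRANSPORT inside the
composite averaging with def-Y's block transporter `qT ι b = parB U (embIter n ι₋) b₋` ([4] (3.12): «U(Γ) along a contour from the centre of the block to
the bond»); by F2 (`B9B8KnitColumnGauge`) the knit's column is, up to `K(d,L)·α·Lⁿ·L^{−n(d+1)}`, the flat column of `R(U₀(Γ^{tree}_{x₀→b₋}))X` with `x₀ = Lⁿw`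
the CORNER of the block `Bⁿ(ι₋)` and `Γ^{tree}` the coordinate-tree contour (`B7Prop1Explicit.treeWord`).  So (H1)–(H2) hold — with `δ₁, δ₂ = O(α)` — for
every transporter family `parB` that READS, at the pairs `(embIter n ι₋, b₋)` with `b₋` in the window of `ι`, the corner-tree transport of `U₀`
(hypothesis `hqT` below), and (H3) holds for every background in the regime (1.7) ([5] (147)).  §3 records one such family explicitly — the
corner-tree family `parBc_n U s s′ := U♯(Γ^{tree}_{x₀(s)→s′})` read through the periodic lift `U♯ = liftCfg U` (a closed term, no `def`) — and §4 the
resulting `hQQ` at `U = bgY i U₀` (the member's background) for EVERY bond function `a`, with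
`ε_Q = (w₋₃∕w₋₁)·(c_fη)²·w_n·2(d+1)·C_τβ_τ·6(d+1)·K₁·η·Lⁿ·LⁿL^{−n(d+1)}·α`, `K₁ = 13344(d+1)(d+2)²(d+5)L^{d+4}` — linear in the regularity `α` of (1.7).
(The def-Y road fixes no `parB` — `B9Thm310DeltaAIsUnitOfExpansion.eBlock_kernelFamilyBInv_GAY_of_coverCubes''` binds it universally; print's centre-taxi
family `parBY` differs from the corner-tree family by a block-size rotation, under which `Q*(U)aQ(U)` is NOT invariant to `O(α)` only columnwise; the
sandwich comparison at `parBY` is the optional file F4.)  Print: [4] (3.12)–(3.13) pp. 392–393, (3.16) p. 393, (3.26) p. 395, (3.41) p. 397; [5] (127) p. 37,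
(139)–(147) pp. 39–40, p. 24; [B8] (1.58)–(1.59) p. 86, p. 77 («Ω_j = T_η»).

WHAT IS PROVED (kernel, 0 sorry; theorems only, no `def`, no `… : Prop` fact, no `instance`).
* §1 (`ℤ^D`): `linQIter_eq_sum_bondsIn` — the flat row decomposition `LʲQ_j(1)G(c) = Σ_{b ⊂ box(c)} LʲQ_j(1)(G(b)·δ_b)(c)`; `col_bound_le` ∕ `row_bound_le` —
  F2's constant `K(D,L) ≤ K₁(D,L) = 13344·D(D+1)²(D+4)L^{D+3}`.
* §2 (torus bookkeeping): `val_embIter` (`(embIter n y)_μ = Lⁿy_μ + (Lⁿ−1)∕2`), `embIter_transl_zero` (the block centre of `0 + w` is `0 + (Lⁿw + (Lⁿ−1)∕2·𝟙)`),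
  `exists_rel_transl_zero` (`rel 0 (0 + y) ∈ y + N₀ℤ^{d+1}`), `liftCfg_isPeriodic`.
* §3: ★★ `qT_cornerTree_eq` — the corner-tree family reads `U♯(Γ^{tree}_{Lⁿw→y})` at every window pair; `qT_cornerTree_mem` (`G`-valued at `G`-valued `U`);
  `cornerTree_flat` (`= 1` at the flat configuration).
* §4: ★★ `H1_of_cornerTree`, ★★ `H2_of_cornerTree`, ★★ `H3_of_reg17`; ★★★ `hQQ_of_cornerTree` (c7 at any `parB` satisfying `hqT`, unitary `qT`);
  ★★★ `hQQ_cornerTree_bgY` (at the corner-tree family and `U = bgY i U₀`, `U₀` unitary, `N₀`-periodic, in `Reg17 L n ℤ^{d+1} α`, `0 < α ≤ α_Q∕L²`).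
* §5: ★★ `QsY_aY_QY_rebase` — exact invariance of `Q*(U)aQ(U)` under index-bond-wise re-basing `qT′ ι f = T_ι·qT ι f`.

HONEST SCOPE.  Per background and per member of constant level; the def-Y-side letters (`hinvC`, `hE`, (Y1)(Y2)) at this `parB` are NOT here; count-neutral;
`stub_PV3A` NOT discharged; nothing continuum ∕ ℝ⁴ ∕ OS ∕ mass gap ∕ Clay — the Yang–Mills mass gap is NOT proved here.  NEW file; F1∕F2∕c2∕c6∕c7 and the
dictionaries are used BY NAME, nothing landed is modified.
-/

noncomputable section

namespace Literature.MathematicalPhysics.QuantumFieldTheory.Balaban1983to89.B9B8KnitAveragingClosenessAtCorner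

open scoped BigOperators
open Node00
open B7Prop1Explicit renaming Site → LSite
open B7Prop1Explicit hiding Site
open B7Prop1Local (InBox AgreeOn loK bondHiK)
open B7Prop2Explicit (unitaryUnits hol_mem_of)
open B7Prop3Flat (insCfg)
open B7Prop4Flat (linQIter linQIter_csmul)
open B7Prop4GeneralLevels (linCovIter)
open B7Prop5Flat (bump BondIn bondsIn mem_bondsIn restr agreeOn_insCfg_restr)
open B7Prop5GeneralLevels (thetaGen)
open B7Eq78Linearization (conjR conjR_smul)
open B8Eq146AExpansion (iEta norm_iEta_le)
open B8Ineq130 (hol_one)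
open B6KLevelCensusIndexV1 (KIdx)
open B6GlobalChartV1 (PV)
open B8ScaledSupNorm (weight)
open B10Eq27TorusAxialLog (transl transl_apply rel transl_rel)
open B15DeterminingSets (embIter)
open B9B8CarrierDictionary (liftCfg liftCfg_apply liftCfg_mem conjR_eq_R)
open B9B8KnitBondTransfer (liftBd descBd liftBd_apply)
open B9B8KnitBondAvgDictionary (linQIter_liftBd_eq_sum_qK linCovIter_one_eq_linQIter val_transl_boxVec)
open B9B8KnitBondAvgColumns (linQIter_bump_eq_smul_qK)
open B9B8KnitBondAvgSupport (window_winBase)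
open B8Thm2TorusMemberWeighted (ibondY_level_eq)
open B9B8KnitColumnFlatness (linQIter_finset_sum exists_winBase_of_inBox thetaGen_le_one)
open B9B8KnitColumnGauge (linCovIter_congr' norm_linCovIter_bump_sub_linQIter_rot_le norm_linCovIter_sub_sum_linQIter_rot_le)
open B9B8KnitAveragingClosenessWeighted (hQQ_of_columns)
open B9B8KnitAveragingClosenessOfColumns (QsY_apply)
open B9B8KnitFlatAveragingAgreement (aY_apply)
open B9Eq316AveragingTransposeZd (betaTau winBase clsField wQ alphaQ alphaQ_pos Reg17 reg17_mono norm_linCovIter_le_of_reg17)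
open B9Eq316AveragingTransposeZdPrinted (QQZdP)
open B8Thm2TorusMember (TorusMember torusIdx torusLamb mem_torusLamb_iff)
open B8Thm2TorusLettersPerOfKnit (bgY liftCfg_bgY bgY_mem)
open B9B8KnitLandauProjection (shiftCfg_eq_of_isPeriodic transl_add_period_smul)
open T4TermwiseTorus (IsPeriodic)
open B9Eq39Adjoint (R R_smul R_add R_inv_R)

variable {d ℓ : ℕ} {hd : 1 ≤ d + 1} {hL : Odd (ℓ + 1) ∧ 1 < ℓ + 1} {b₀ b₁ : ℝ}

/-! ## §1 `ℤ^D`: the flat row decomposition and the size of F2's constant -/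

section FlatRow

variable {D : ℕ} {𝔸 : Type} [CStarAlgebra 𝔸] [Nontrivial 𝔸] (L : ℕ)

omit [Nontrivial 𝔸] in
/-- the restriction of a bond field to a finite bond set is the finite sum of its single-bond bumps. [cite: Balaban1985Averaging, p.24 (finitely many bond variables), bookkeeping] -/
private theorem insCfg_restr_eq_sum' (S : Finset (LSite D × Fin D)) (B : LSite D → Fin D → 𝔸) :
    insCfg S (restr S B) = ∑ s ∈ S, bump s.1 s.2 (B s.1 s.2) := by
  classical
  funext x κ
  rw [Finset.sum_apply, Finset.sum_apply]
  simp only [bump, insCfg, restr]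
  by_cases h : (x, κ) ∈ S
  · rw [dif_pos h, Finset.sum_eq_single (x, κ)]
    · simp
    · rintro ⟨x', κ'⟩ _ hne
      rw [if_neg]
      rintro ⟨rfl, rfl⟩
      exact hne rfl
    · intro hn; exact absurd h hn
  · rw [dif_neg h]
    symm
    refine Finset.sum_eq_zero fun s hs => ?_
    rw [if_neg]
    rintro ⟨rfl, rfl⟩
    exact h hs

/-- ★ **THE FLAT ROW DECOMPOSITION**: the flat composite linear averaging at a level-`j` bond reads a bounded field only through the bonds of the double box,
additively: `LʲQ_j(1)G(w,κ) = Σ_{b ⊂ Bʲ(c₋)∪Bʲ(c₊)} LʲQ_j(1)(G(b)·δ_b)(w,κ)`. [cite: Balaban1985Averaging, (127) p.37, p.24 (after (43))] -/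
theorem linQIter_eq_sum_bondsIn (hL : 1 ≤ L) (G : LSite D → Fin D → 𝔸) {b : ℝ} (hb : 0 ≤ b) (hG : ∀ x ν, ‖G x ν‖ ≤ b)
    (j : ℕ) (w : LSite D) (κ : Fin D) :
    linQIter L G j w κ = ∑ s ∈ bondsIn (loK L j w) (bondHiK L j w κ), linQIter L (bump s.1 s.2 (G s.1 s.2)) j w κ := by
  classical
  have hG' : ∀ x ν, ‖insCfg (bondsIn (loK L j w) (bondHiK L j w κ)) (restr (bondsIn (loK L j w) (bondHiK L j w κ)) G) x ν‖ ≤ b :=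
    fun x ν => by
      unfold insCfg restr
      split_ifs
      · exact hG _ _
      · rw [norm_zero]; exact hb
  have h1 : linQIter L G j w κ = linQIter L (insCfg (bondsIn (loK L j w) (bondHiK L j w κ)) (restr (bondsIn (loK L j w) (bondHiK L j w κ)) G)) j w κ := by
    rw [← linCovIter_one_eq_linQIter hL G hb hG j, ← linCovIter_one_eq_linQIter hL _ hb hG' j]
    exact linCovIter_congr' L hL j w κ (fun _ _ _ _ => rfl) (agreeOn_insCfg_restr _ _ G)
  rw [h1, insCfg_restr_eq_sum', linQIter_finset_sum, Finset.sum_apply, Finset.sum_apply]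

omit [CStarAlgebra 𝔸] [Nontrivial 𝔸] in
/-- the size of F2's column constant: `K(D,L) = 4D·L^D·(3200(D+1)²(D+4)L³ + (128D² + 8D(D+1))(D+1)L³L^{−(D+1)}) ≤ 13344·D(D+1)²(D+4)·L^{D+3}` (`L ≥ 1`).
[cite: Balaban1985Averaging, (139) p.39 («the constant C₁ depends on d and L»), bookkeeping] -/
theorem colConst_le (hL : 1 ≤ L) :
    4 * D * (L : ℝ) ^ D *
        ((3200 * ((D : ℝ) + 1) ^ 2 * ((D : ℝ) + 4) * (L : ℝ) ^ 3 + 128 * (D : ℝ) ^ 2 * ((D : ℝ) + 1) * ((L : ℝ) ^ 3 * ((L : ℝ) ^ (D + 1))⁻¹)) +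
          8 * D * ((D : ℝ) + 1) * ((L : ℝ) ^ 3 * ((L : ℝ) ^ (D + 1))⁻¹) * ((D : ℝ) + 1)) ≤
      13344 * D * ((D : ℝ) + 1) ^ 2 * ((D : ℝ) + 4) * (L : ℝ) ^ (D + 3) := by
  have hL1 : (1 : ℝ) ≤ L := by exact_mod_cast hL
  have hL0 : (0 : ℝ) < L := by linarith
  have hD0 : (0 : ℝ) ≤ D := Nat.cast_nonneg D
  set r : ℝ := (L : ℝ) ^ 3 * ((L : ℝ) ^ (D + 1))⁻¹ with hr
  have hr0 : 0 ≤ r := by positivity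
  have hrL : r ≤ (L : ℝ) ^ 3 := by
    have h1 : (1 : ℝ) ≤ (L : ℝ) ^ (D + 1) := one_le_pow₀ hL1
    have h2 : ((L : ℝ) ^ (D + 1))⁻¹ ≤ 1 := inv_le_one_of_one_le₀ h1
    calc r = (L : ℝ) ^ 3 * ((L : ℝ) ^ (D + 1))⁻¹ := hr
      _ ≤ (L : ℝ) ^ 3 * 1 := mul_le_mul_of_nonneg_left h2 (by positivity)
      _ = (L : ℝ) ^ 3 := mul_one _
  have hA : (D : ℝ) ^ 2 * ((D : ℝ) + 1) ≤ ((D : ℝ) + 1) ^ 2 * ((D : ℝ) + 4) := by nlinarith [sq_nonneg (D : ℝ)]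
  have hB : (D : ℝ) * ((D : ℝ) + 1) * ((D : ℝ) + 1) ≤ ((D : ℝ) + 1) ^ 2 * ((D : ℝ) + 4) := by nlinarith [sq_nonneg (D : ℝ)]
  have e1 : 128 * (D : ℝ) ^ 2 * ((D : ℝ) + 1) * r ≤ 128 * (((D : ℝ) + 1) ^ 2 * ((D : ℝ) + 4)) * (L : ℝ) ^ 3 := by
    have := mul_le_mul hA hrL hr0 (by positivity)
    nlinarith
  have e2 : 8 * D * ((D : ℝ) + 1) * r * ((D : ℝ) + 1) ≤ 8 * (((D : ℝ) + 1) ^ 2 * ((D : ℝ) + 4)) * (L : ℝ) ^ 3 := by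
    have := mul_le_mul hB hrL hr0 (by positivity)
    nlinarith
  have hbr : 3200 * ((D : ℝ) + 1) ^ 2 * ((D : ℝ) + 4) * (L : ℝ) ^ 3 + 128 * (D : ℝ) ^ 2 * ((D : ℝ) + 1) * r +
      8 * D * ((D : ℝ) + 1) * r * ((D : ℝ) + 1) ≤ 3336 * ((D : ℝ) + 1) ^ 2 * ((D : ℝ) + 4) * (L : ℝ) ^ 3 := by nlinarith
  calc 4 * D * (L : ℝ) ^ D *
        (3200 * ((D : ℝ) + 1) ^ 2 * ((D : ℝ) + 4) * (L : ℝ) ^ 3 + 128 * (D : ℝ) ^ 2 * ((D : ℝ) + 1) * r +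
          8 * D * ((D : ℝ) + 1) * r * ((D : ℝ) + 1))
      ≤ 4 * D * (L : ℝ) ^ D * (3336 * ((D : ℝ) + 1) ^ 2 * ((D : ℝ) + 4) * (L : ℝ) ^ 3) :=
        mul_le_mul_of_nonneg_left hbr (by positivity)
    _ = 13344 * D * ((D : ℝ) + 1) ^ 2 * ((D : ℝ) + 4) * (L : ℝ) ^ (D + 3) := by rw [pow_add]; ring

omit [CStarAlgebra 𝔸] [Nontrivial 𝔸] in
/-- F2's column bound with the compact constant `K₁(D,L) = 13344·D(D+1)²(D+4)·L^{D+3}`. [cite: Balaban1985Averaging, (139)–(147) pp.39–40, bookkeeping] -/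
theorem col_bound_le (hL : 1 ≤ L) {α lam nx : ℝ} (hα : 0 ≤ α) (hlam : 0 ≤ lam) (hnx : 0 ≤ nx) :
    4 * D * (L : ℝ) ^ D *
        ((3200 * ((D : ℝ) + 1) ^ 2 * ((D : ℝ) + 4) * (L : ℝ) ^ 3 + 128 * (D : ℝ) ^ 2 * ((D : ℝ) + 1) * ((L : ℝ) ^ 3 * ((L : ℝ) ^ (D + 1))⁻¹)) +
          8 * D * ((D : ℝ) + 1) * ((L : ℝ) ^ 3 * ((L : ℝ) ^ (D + 1))⁻¹) * ((D : ℝ) + 1)) * α * lam * nx ≤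
      13344 * D * ((D : ℝ) + 1) ^ 2 * ((D : ℝ) + 4) * (L : ℝ) ^ (D + 3) * α * lam * nx := by
  have h := colConst_le (D := D) L hL
  have hp : 0 ≤ α * lam * nx := by positivity
  have := mul_le_mul_of_nonneg_right h hp
  linarith [this]

omit [CStarAlgebra 𝔸] [Nontrivial 𝔸] in
/-- F2's row bound with the compact constant `K₁(D,L)`. [cite: Balaban1985Averaging, (139)–(147) pp.39–40, bookkeeping] -/
theorem row_bound_le (hL : 1 ≤ L) {α p b : ℝ} (hα : 0 ≤ α) (hp : 0 ≤ p) (hb : 0 ≤ b) :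
    2 * D * (4 * D * (L : ℝ) ^ D *
        ((3200 * ((D : ℝ) + 1) ^ 2 * ((D : ℝ) + 4) * (L : ℝ) ^ 3 + 128 * (D : ℝ) ^ 2 * ((D : ℝ) + 1) * ((L : ℝ) ^ 3 * ((L : ℝ) ^ (D + 1))⁻¹)) +
          8 * D * ((D : ℝ) + 1) * ((L : ℝ) ^ 3 * ((L : ℝ) ^ (D + 1))⁻¹) * ((D : ℝ) + 1))) * α * p * b ≤
      2 * D * (13344 * D * ((D : ℝ) + 1) ^ 2 * ((D : ℝ) + 4) * (L : ℝ) ^ (D + 3)) * α * p * b := by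
  have h := colConst_le (D := D) L hL
  have hD0 : (0 : ℝ) ≤ D := Nat.cast_nonneg D
  have hq : 0 ≤ 2 * (D : ℝ) * (α * p * b) := by positivity
  have := mul_le_mul_of_nonneg_left h hq
  nlinarith [this]

end FlatRow

/-! ## §2 Torus bookkeeping: block centres, representatives, periodic lifts -/

section Torus

/-- half-integers of odd powers: `(L−1)∕2·Lⁿ + (Lⁿ−1)∕2 = (L^{n+1}−1)∕2` for odd `L`. [cite: Balaban1987RG1, (0.1) p.252 («centres of cubes of odd side»), bookkeeping] -/
private theorem half_pred_mul_pow_add {L : ℕ} (hLo : Odd L) (n : ℕ) :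
    (L - 1) / 2 * L ^ n + (L ^ n - 1) / 2 = (L ^ (n + 1) - 1) / 2 := by
  obtain ⟨a, rfl⟩ := hLo
  obtain ⟨b, hb⟩ := ((odd_two_mul_add_one a).pow : Odd ((2 * a + 1) ^ n))
  rw [pow_succ, hb]
  have h3 : (2 * b + 1) * (2 * a + 1) = 2 * (a * (2 * b + 1) + b) + 1 := by ring
  have h1 : (2 * a + 1 - 1) / 2 = a := by omega
  rw [h3, h1]
  generalize a * (2 * b + 1) = p
  omega

/-- **LABELS OF THE ITERATED CENTRE EMBEDDING**: `(embIter n y)_μ = y_μ·Lⁿ + (Lⁿ − 1)∕2` (`Setup.emb` = centre convention, `L` odd; standing range `n ≤ m + K`).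
[cite: Balaban1987RG1, (0.1) p.251–252] -/
theorem val_embIter {P : Params} : ∀ {n : ℕ}, n ≤ P.m + P.K → ∀ (y : Site P n) (μ : Fin P.d),
    ((embIter n y) μ).val = (y μ).val * P.L ^ n + (P.L ^ n - 1) / 2
  | 0, _, y, μ => by simp [embIter]
  | n + 1, hn, y, μ => by
    show ((embIter n (emb y)) μ).val = _
    rw [val_embIter (by omega) (emb y) μ, Site.val_emb (by omega) y μ, add_mul, mul_assoc, ← pow_succ', add_assoc,
      half_pred_mul_pow_add P.hL.1 n]

variable {𝔸 : Type} [NormedRing 𝔸] [NormedAlgebra ℂ 𝔸] [CompleteSpace 𝔸] (i : KIdx d ℓ hd hL b₀ b₁)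

/-- **THE BLOCK CENTRE OF A TRANSLATE**: for `w ∈ ℤ^{d+1}` and `n ≤ m + K`, the level-`0` representative (`embIter n`, centre convention) of the level-`n` site
`0 + w` is `0 + (Lⁿw + (Lⁿ−1)∕2·𝟙)`. [cite: Balaban1987RG1, (0.1) p.251–252; Balaban1985BackgroundPropagators, (3.12) p.392 («from the centre of the block»)] -/
theorem embIter_transl_zero {n : ℕ} (hn : n ≤ i.m + i.K) (w : LSite (d + 1)) :
    embIter n (transl (0 : Site (PV d ℓ i.m i.K hd hL) n) w) =
      transl (0 : Site (PV d ℓ i.m i.K hd hL) 0) (fun ν => (((ℓ + 1) ^ n : ℕ) : ℤ) * w ν + ((((ℓ + 1) ^ n - 1) / 2 : ℕ) : ℤ)) := by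
  have hc : ((ℓ + 1) ^ n - 1) / 2 < (ℓ + 1) ^ n := by
    have : 1 ≤ (ℓ + 1) ^ n := Nat.one_le_pow _ _ (by omega)
    omega
  set r : Fin (d + 1) → Fin ((ℓ + 1) ^ n) := fun _ => ⟨((ℓ + 1) ^ n - 1) / 2, hc⟩ with hr
  have hpt : (fun ν => (((ℓ + 1) ^ n : ℕ) : ℤ) * w ν + ((((ℓ + 1) ^ n - 1) / 2 : ℕ) : ℤ)) =
      (((ℓ + 1) ^ n : ℕ) : ℤ) • w + boxVec ((ℓ + 1) ^ n) r := by
    funext ν; simp [boxVec, hr]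
  rw [hpt]
  funext ν
  apply ZMod.val_injective
  rw [val_transl_boxVec (d := d) (ℓ := ℓ) (m := i.m) (K := i.K) (hd := hd) (hL := hL) hn w r ν,
    val_embIter (P := PV d ℓ i.m i.K hd hL) hn _ ν]
  simp only [hr]
  show _ * (ℓ + 1) ^ n + ((ℓ + 1) ^ n - 1) / 2 = _
  ring

/-- **REPRESENTATIVES OF A TRANSLATE**: the centred representative of `0 + y` differs from `y` by a period vector: `rel 0 (0 + y) ∈ y + N₀·ℤ^{d+1}`.
[cite: Balaban1987RG1, (0.1) p.251, bookkeeping] -/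
theorem exists_rel_transl_zero (y : LSite (d + 1)) :
    ∃ mv : LSite (d + 1), rel (0 : Site (PV d ℓ i.m i.K hd hL) 0) (transl (0 : Site (PV d ℓ i.m i.K hd hL) 0) y) =
      y + ((((PV d ℓ i.m i.K hd hL).sitesPerDir 0 : ℕ) : ℤ)) • mv := by
  have h := transl_rel (0 : Site (PV d ℓ i.m i.K hd hL) 0) (transl (0 : Site (PV d ℓ i.m i.K hd hL) 0) y)
  have hdvd : ∀ ν, ((((PV d ℓ i.m i.K hd hL).sitesPerDir 0 : ℕ) : ℤ)) ∣
      rel (0 : Site (PV d ℓ i.m i.K hd hL) 0) (transl (0 : Site (PV d ℓ i.m i.K hd hL) 0) y) ν - y ν := fun ν => by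
    have hν := congrFun h ν
    rw [transl_apply, transl_apply] at hν
    exact (ZMod.intCast_eq_intCast_iff_dvd_sub _ _ _).1 (add_left_cancel hν).symm
  refine ⟨fun ν => (rel (0 : Site (PV d ℓ i.m i.K hd hL) 0) (transl (0 : Site (PV d ℓ i.m i.K hd hL) 0) y) ν - y ν) /
    ((((PV d ℓ i.m i.K hd hL).sitesPerDir 0 : ℕ) : ℤ)), funext fun ν => ?_⟩
  simp only [Pi.add_apply, Pi.smul_apply, smul_eq_mul]
  rw [Int.mul_ediv_cancel' (hdvd ν)]
  ring

/-- the periodic lift of a torus configuration is `N₀`-periodic (full period lattice). [cite: Balaban1985RegularSpaces, (1.3) p.77, bookkeeping] -/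
theorem liftCfg_isPeriodic (U : CfgY 𝔸 i) : IsPeriodic ((PV d ℓ i.m i.K hd hL).sitesPerDir 0) (liftCfg U) := fun x mv => by
  funext μ
  rw [liftCfg_apply, liftCfg_apply, transl_add_period_smul]

end Torus

/-! ## §3 The corner-tree transporter family

For a member level `n`, the CORNER-TREE family is the closed term
`parBc_n := fun U s s′ ↦ U♯(Γ^{tree}_{x₀ → s′})`, `U♯ = liftCfg U` (periodic lift), where — reading `s` as the centre `embIter n ι₋` of a level-`n` block —
the corner is `x₀ = s − (Lⁿ−1)∕2·𝟙` and the tree contour's displacement is the least residue `v_ν = val(s′_ν − s_ν + (Lⁿ−1)∕2) ∈ [0, N₀)`, spelled from the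
integer base point `rel 0 s′ − v ≡ x₀`.  No `def` is introduced: the family is written out in each statement. -/

section CornerTree

variable {𝔸 : Type} [NormedRing 𝔸] [NormedAlgebra ℂ 𝔸] [CompleteSpace 𝔸] (i : KIdx d ℓ hd hL b₀ b₁)

/-- ★★ **THE CORNER-TREE FAMILY READS THE CORNER-TREE TRANSPORT OF THE LIFT AT EVERY WINDOW PAIR**: for an index bond `ι` of level `n` with `ι₋ = 0 + w`,
`w = winBase L n y κ t` a window base of `y ∈ ℤ^{d+1}` (so `0 ≤ y − Lⁿw < 2Lⁿ ≤ N₀` coordinatewise), and any direction `μ`: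
`qT parBc_n U ι ⟨0 + y, μ⟩ = U♯(Γ^{tree}_{Lⁿw → y})` (`U♯ = liftCfg U`; def-Y's `qT ι b = parB U (embIter n ι₋) b₋`, the centre `embIter n (0 + w) = 0 + (Lⁿw + (Lⁿ−1)∕2·𝟙)`,
periodicity of `U♯`). [cite: Balaban1985BackgroundPropagators, (3.12) p.392; Balaban1985Averaging, p.24, (141) p.39; Balaban1987RG1, (0.1) p.251–252] -/
theorem qT_cornerTree_eq {n : ℕ} (U : CfgY 𝔸 i) (ι : IBondY i) (hn : ((ι.1.1 : ℕ)) = n)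
    (y : LSite (d + 1)) (μ κ : Fin (d + 1)) (t : Fin 2)
    (hsrc : ι.1.2.src = transl (0 : Site (PV d ℓ i.m i.K hd hL) (ι.1.1 : ℕ)) (winBase (ℓ + 1) n y κ t)) :
    qT i (fun (V : CfgY 𝔸 i) (s s' : Site (PV d ℓ i.m i.K hd hL) 0) =>
        hol (liftCfg V)
          (rel (0 : Site (PV d ℓ i.m i.K hd hL) 0) s' -
            fun ν => ((((s' ν - s ν + ((((ℓ + 1) ^ n - 1) / 2 : ℕ) : ZMod ((PV d ℓ i.m i.K hd hL).sitesPerDir 0))).val : ℕ) : ℤ)))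
          (treeWord fun ν => ((((s' ν - s ν + ((((ℓ + 1) ^ n - 1) / 2 : ℕ) : ZMod ((PV d ℓ i.m i.K hd hL).sitesPerDir 0))).val : ℕ) : ℤ))))
      U ι ⟨transl (0 : Site (PV d ℓ i.m i.K hd hL) 0) y, μ⟩ =
      hol (liftCfg U) (loK (ℓ + 1) n (winBase (ℓ + 1) n y κ t)) (treeWord (y - loK (ℓ + 1) n (winBase (ℓ + 1) n y κ t))) := by
  subst hn
  have hL1 : 1 ≤ ℓ + 1 := by omega
  have hjK : ((ι.1.1 : ℕ)) ≤ i.m + i.K := B6Ineq2142KLevelV1.lvl_le_mK i.hN i.D i.hk ι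
  have hwin := window_winBase (d := d) hL1 (ι.1.1 : ℕ) y κ t
  -- unfold def-Y's transporter and read the block centre
  simp only [qT]
  rw [hsrc, embIter_transl_zero i hjK]
  set N : ℕ := (ℓ + 1) ^ (ι.1.1 : ℕ) with hN
  set w := winBase (ℓ + 1) (ι.1.1 : ℕ) y κ t with hw
  set c : ℕ := (N - 1) / 2 with hc
  have hP₀ : ((((PV d ℓ i.m i.K hd hL).sitesPerDir 0 : ℕ) : ℤ)) = 2 * (((ℓ + 1) ^ (i.m + i.K) : ℕ) : ℤ) := by
    simp [Params.sitesPerDir]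
  have hNle : ((N : ℕ) : ℤ) ≤ (((ℓ + 1) ^ (i.m + i.K) : ℕ) : ℤ) := by
    rw [hN]; exact_mod_cast Nat.pow_le_pow_right hL1 hjK
  -- periodicity of the lift absorbs the period vector between `rel 0 (0 + y)` and `y`
  have key : ∀ V : LSite (d + 1), V = y - loK (ℓ + 1) (ι.1.1 : ℕ) w →
      hol (liftCfg U) (rel (0 : Site (PV d ℓ i.m i.K hd hL) 0) (transl (0 : Site (PV d ℓ i.m i.K hd hL) 0) y) - V) (treeWord V) =
        hol (liftCfg U) (loK (ℓ + 1) (ι.1.1 : ℕ) w) (treeWord (y - loK (ℓ + 1) (ι.1.1 : ℕ) w)) := by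
    intro V hV
    subst hV
    obtain ⟨mv, hmv⟩ := exists_rel_transl_zero i y
    rw [hmv, show y + ((((PV d ℓ i.m i.K hd hL).sitesPerDir 0 : ℕ) : ℤ)) • mv - (y - loK (ℓ + 1) (ι.1.1 : ℕ) w) =
      loK (ℓ + 1) (ι.1.1 : ℕ) w + ((((PV d ℓ i.m i.K hd hL).sitesPerDir 0 : ℕ) : ℤ)) • mv by abel]
    exact (liftCfg_isPeriodic i U).hol _ _ mv
  refine key _ (funext fun ν => ?_)
  dsimp only
  -- the displacement read on the torus IS `y − Lⁿw`
  have h1 : transl (0 : Site (PV d ℓ i.m i.K hd hL) 0) y ν -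
      transl (0 : Site (PV d ℓ i.m i.K hd hL) 0) (fun ν => ((N : ℕ) : ℤ) * w ν + ((c : ℕ) : ℤ)) ν +
      ((c : ℕ) : ZMod ((PV d ℓ i.m i.K hd hL).sitesPerDir 0)) =
      (((y ν - ((N : ℕ) : ℤ) * w ν : ℤ)) : ZMod ((PV d ℓ i.m i.K hd hL).sitesPerDir 0)) := by
    rw [transl_apply, transl_apply, show (0 : Site (PV d ℓ i.m i.K hd hL) 0) ν = 0 from rfl]
    push_cast
    ring
  rw [h1, ZMod.val_intCast]
  have h0 : 0 ≤ y ν - ((N : ℕ) : ℤ) * w ν := by have := (hwin ν).1; linarith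
  have h2 : y ν - ((N : ℕ) : ℤ) * w ν < ((((PV d ℓ i.m i.K hd hL).sitesPerDir 0 : ℕ) : ℤ)) := by
    have := (hwin ν).2; rw [hP₀]; linarith
  rw [Int.emod_eq_of_lt h0 h2, Pi.sub_apply]
  simp [loK, hN]

/-- the corner-tree family is `G`-valued at `G`-valued configurations (in particular unitary at unitary `U`). [cite: Balaban1985BackgroundPropagators, p.390 («with values in G»), (3.12) p.392] -/
theorem qT_cornerTree_mem {n : ℕ} {G : Subgroup 𝔸ˣ} {U : CfgY 𝔸 i} (hU : ∀ μ x, U μ x ∈ G) (ι : IBondY i) (f : FBondY i) :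
    qT i (fun (V : CfgY 𝔸 i) (s s' : Site (PV d ℓ i.m i.K hd hL) 0) =>
        hol (liftCfg V)
          (rel (0 : Site (PV d ℓ i.m i.K hd hL) 0) s' -
            fun ν => ((((s' ν - s ν + ((((ℓ + 1) ^ n - 1) / 2 : ℕ) : ZMod ((PV d ℓ i.m i.K hd hL).sitesPerDir 0))).val : ℕ) : ℤ)))
          (treeWord fun ν => ((((s' ν - s ν + ((((ℓ + 1) ^ n - 1) / 2 : ℕ) : ZMod ((PV d ℓ i.m i.K hd hL).sitesPerDir 0))).val : ℕ) : ℤ))))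
      U ι f ∈ G := by
  simp only [qT]
  exact hol_mem_of (fun z μ => liftCfg_mem hU z μ) _ _

/-- the corner-tree family is trivial at the flat configuration (`parBc_n 1 = 1`). [cite: Balaban1985BackgroundPropagators, (3.12) p.392, bookkeeping] -/
theorem cornerTree_flat {n : ℕ} (s s' : Site (PV d ℓ i.m i.K hd hL) 0) :
    (fun (V : CfgY 𝔸 i) (s s' : Site (PV d ℓ i.m i.K hd hL) 0) =>
        hol (liftCfg V)
          (rel (0 : Site (PV d ℓ i.m i.K hd hL) 0) s' -
            fun ν => ((((s' ν - s ν + ((((ℓ + 1) ^ n - 1) / 2 : ℕ) : ZMod ((PV d ℓ i.m i.K hd hL).sitesPerDir 0))).val : ℕ) : ℤ)))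
          (treeWord fun ν => ((((s' ν - s ν + ((((ℓ + 1) ^ n - 1) / 2 : ℕ) : ZMod ((PV d ℓ i.m i.K hd hL).sitesPerDir 0))).val : ℕ) : ℤ))))
      (fun _ _ => (1 : 𝔸ˣ)) s s' = 1 := by
  show hol _ _ _ = 1
  have h1 : liftCfg (P := PV d ℓ i.m i.K hd hL) (fun (_ : Fin (d + 1)) (_ : Site (PV d ℓ i.m i.K hd hL) 0) => (1 : 𝔸ˣ)) = 1 := by
    funext z μ; rfl
  rw [h1]
  exact hol_one _ _

end CornerTree

/-! ## §4 The junction: (H1)–(H3) and `hQQ` at a corner-tree-reading family, per background -/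

section Junction

variable {𝔸 : Type} [CStarAlgebra 𝔸] [Nontrivial 𝔸] [FiniteDimensional ℝ 𝔸] (τ : 𝔸 →ₗ[ℂ] ℂ) (i : KIdx d ℓ hd hL b₀ b₁) {n : ℕ}

omit [FiniteDimensional ℝ 𝔸] in
/-- ★★ **(H3) FROM THE REGIME (1.7)**: for a unitary `U₀ ∈ Reg17 L n ℤ^{d+1} α` (`0 < α ≤ α_Q`), `η ≥ 0`, every bond function `a` and level-`n` bond `c`:
`‖(−i)·LⁿQ_n(U₀)(iη·a♯)(c)‖ ≤ 4(d+1)·Lⁿ·η·‖a‖` — [5] (147) for the composite averaging of a field bounded by `η‖a‖` (`B9Eq316AveragingTransposeZd.norm_linCovIter_le_of_reg17`,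
`1 + ϑ ≤ 2`). [cite: Balaban1985Averaging, (147) p.40; Balaban1985BackgroundPropagators, (3.16) p.393] -/
theorem H3_of_reg17 {α : ℝ} (hα : 0 < α) (hαQ : α ≤ alphaQ (d + 1) (ℓ + 1))
    {U₀ : LSite (d + 1) → Fin (d + 1) → 𝔸ˣ} (hU₀ : ∀ x κ, U₀ x κ ∈ unitaryUnits 𝔸)
    (hreg : Reg17 (ℓ + 1) n (fun _ => (Set.univ : Set (LSite (d + 1)))) α U₀) {η : ℝ} (hη : 0 ≤ η)
    (a : FBondY i → 𝔸) (w : LSite (d + 1)) (κ : Fin (d + 1)) :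
    ‖clsField (ℓ + 1) (fun m' => torusLamb (d := d + 1) m') η n n U₀ (liftBd i a) w κ‖ ≤
      4 * ((d : ℝ) + 1) * (((ℓ + 1 : ℕ) : ℝ)) ^ n * η * ‖a‖ := by
  have hℓ : 2 ≤ ℓ + 1 := hL.2
  have hL1 : 1 ≤ ℓ + 1 := by omega
  have e1 : clsField (ℓ + 1) (fun m' => torusLamb (d := d + 1) m') η n n U₀ (liftBd i a) w κ =
      (-Complex.I) • linCovIter (ℓ + 1) U₀ (iEta η (liftBd i a)) n w κ := by
    simp [clsField, mem_torusLamb_iff]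
  have hB : ∀ x ν, BondIn (loK (ℓ + 1) n w) (bondHiK (ℓ + 1) n w κ) x ν → ‖iEta η (liftBd i a) x ν‖ ≤ η * ‖a‖ := fun x ν _ =>
    norm_iEta_le hη (fun z μ => by rw [liftBd_apply]; exact norm_le_pi_norm a _) x ν
  have h := norm_linCovIter_le_of_reg17 hℓ hα hαQ hU₀ hreg le_rfl w κ (fun _ _ => Set.mem_univ _) (iEta η (liftBd i a))
    (by positivity) hB
  have hθ : thetaGen (d + 1) (ℓ + 1) α ≤ 1 := thetaGen_le_one hL1 hαQ
  rw [e1, norm_smul, norm_neg, Complex.norm_I, one_mul]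
  refine h.trans ?_
  have hLn : (0 : ℝ) ≤ (((ℓ + 1 : ℕ) : ℝ)) ^ n := by positivity
  have hna : 0 ≤ η * ‖a‖ := by positivity
  have h1 : (1 + thetaGen (d + 1) (ℓ + 1) α) * (((ℓ + 1 : ℕ) : ℝ)) ^ n ≤ 2 * (((ℓ + 1 : ℕ) : ℝ)) ^ n :=
    mul_le_mul_of_nonneg_right (by linarith) hLn
  calc 2 * ((d + 1 : ℕ) : ℝ) * ((1 + thetaGen (d + 1) (ℓ + 1) α) * (((ℓ + 1 : ℕ) : ℝ)) ^ n) * (η * ‖a‖)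
      ≤ 2 * ((d + 1 : ℕ) : ℝ) * (2 * (((ℓ + 1 : ℕ) : ℝ)) ^ n) * (η * ‖a‖) := by gcongr
    _ = 4 * ((d : ℝ) + 1) * (((ℓ + 1 : ℕ) : ℝ)) ^ n * η * ‖a‖ := by push_cast; ring

omit [FiniteDimensional ℝ 𝔸] in
/-- ★★ **(H1) AT A CORNER-TREE-READING FAMILY**: at a member of constant level `n`, for a unitary `U₀ ∈ Reg17 L n ℤ^{d+1} α` (`0 < α ≤ α_Q`) and any `parB`,
`U` whose transporters read the corner-tree transport of `U₀` at the window pairs (`hqT`): for every fine bond `f`, index bond `ι` over a window bond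
`(w, κ)` of `rel 0 f₋` and `X`, `‖LⁿQ_n(U₀)(X·δ_{(rel 0 f₋, f.dir)})(w,κ) − (Lⁿ·qK ι f)·R(qT ι f)X‖ ≤ K₁·α·LⁿL^{−n(d+1)}·‖X‖` — F2's column theorem + c2-II's flat
column `LⁿQ_n(1)(X′·δ)(w,κ) = Lⁿ·qK ι f·X′` at `X′ = R(U₀(Γ^{tree}))X`. [cite: Balaban1985Averaging, (139)–(147) pp.39–40, (127) p.37; Balaban1985BackgroundPropagators, (3.12) p.392, (3.16) p.393] -/
theorem H1_of_cornerTree (hD : ∀ x, i.D.lev x = n) (hk : i.k = n + 1)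
    {α : ℝ} (hα : 0 < α) (hαQ : α ≤ alphaQ (d + 1) (ℓ + 1))
    {U₀ : LSite (d + 1) → Fin (d + 1) → 𝔸ˣ} (hU₀ : ∀ x κ, U₀ x κ ∈ unitaryUnits 𝔸)
    (hreg : Reg17 (ℓ + 1) n (fun _ => (Set.univ : Set (LSite (d + 1)))) α U₀)
    (parB : BondParY 𝔸 i) (U : CfgY 𝔸 i)
    (hqT : ∀ (ι : IBondY i) (y : LSite (d + 1)) (μ κ : Fin (d + 1)) (t : Fin 2),
      ι.1.2.src = transl (0 : Site (PV d ℓ i.m i.K hd hL) (ι.1.1 : ℕ)) (winBase (ℓ + 1) n y κ t) →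
      qT i parB U ι ⟨transl (0 : Site (PV d ℓ i.m i.K hd hL) 0) y, μ⟩ =
        hol U₀ (loK (ℓ + 1) n (winBase (ℓ + 1) n y κ t)) (treeWord (y - loK (ℓ + 1) n (winBase (ℓ + 1) n y κ t))))
    (f : FBondY i) (ι : IBondY i) (κ : Fin (d + 1)) (t : Fin 2)
    (hsrc : ι.1.2.src = transl (0 : Site (PV d ℓ i.m i.K hd hL) (ι.1.1 : ℕ))
      (winBase (ℓ + 1) n (rel (0 : Site (PV d ℓ i.m i.K hd hL) 0) f.src) κ t))
    (hdir : ι.1.2.dir = κ) (X : 𝔸) :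
    ‖linCovIter (ℓ + 1) U₀ (bump (rel (0 : Site (PV d ℓ i.m i.K hd hL) 0) f.src) f.dir X) n
        (winBase (ℓ + 1) n (rel (0 : Site (PV d ℓ i.m i.K hd hL) 0) f.src) κ t) κ -
      (((((ℓ + 1 : ℕ) : ℝ)) ^ n * qK i ι f : ℝ) : ℂ) • R (qT i parB U ι f) X‖ ≤
      13344 * ((d : ℝ) + 1) * ((d : ℝ) + 2) ^ 2 * ((d : ℝ) + 5) * (((ℓ + 1 : ℕ) : ℝ)) ^ (d + 4) * α *
        ((((ℓ + 1 : ℕ) : ℝ)) ^ n * (((((ℓ + 1 : ℕ) : ℝ)) ^ (d + 1)) ^ n)⁻¹) * ‖X‖ := by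
  have hℓ : 2 ≤ ℓ + 1 := hL.2
  have hL1 : 1 ≤ ℓ + 1 := by omega
  have hd1 : 1 ≤ d + 1 := by omega
  have hn : ((ι.1.1 : ℕ)) = n := ibondY_level_eq i hD hk ι
  obtain ⟨s, μ⟩ := f
  simp only at hsrc ⊢
  -- the transporter read by `parB` at `(ι, f)` is the corner-tree transport
  have hq : qT i parB U ι ⟨s, μ⟩ = hol U₀ (loK (ℓ + 1) n (winBase (ℓ + 1) n (rel (0 : Site (PV d ℓ i.m i.K hd hL) 0) s) κ t))
      (treeWord (rel (0 : Site (PV d ℓ i.m i.K hd hL) 0) s - loK (ℓ + 1) n (winBase (ℓ + 1) n (rel (0 : Site (PV d ℓ i.m i.K hd hL) 0) s) κ t))) := by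
    have h := hqT ι (rel (0 : Site (PV d ℓ i.m i.K hd hL) 0) s) μ κ t hsrc
    rwa [transl_rel] at h
  -- c2-II: the flat column of the rotated bump is def-Y's kernel entry
  have hflat := linQIter_bump_eq_smul_qK i ι (winBase (ℓ + 1) n (rel (0 : Site (PV d ℓ i.m i.K hd hL) 0) s) κ t)
    (rel (0 : Site (PV d ℓ i.m i.K hd hL) 0) s) μ hsrc.symm (fun ν => by rw [hn]; exact window_winBase hL1 n _ κ t ν)
    (conjR (qT i parB U ι ⟨s, μ⟩) X)
  rw [hdir] at hflat
  rw [hn, transl_rel] at hflat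
  -- F2's column theorem
  have hcol := norm_linCovIter_bump_sub_linQIter_rot_le hℓ hd1 hα hαQ hU₀ hreg
    (winBase (ℓ + 1) n (rel (0 : Site (PV d ℓ i.m i.K hd hL) 0) s) κ t) κ (rel (0 : Site (PV d ℓ i.m i.K hd hL) 0) s) μ X
  rw [← hq, hflat, conjR_eq_R] at hcol
  refine (hcol.trans (col_bound_le (D := d + 1) (ℓ + 1) hL1 hα.le (by positivity) (norm_nonneg X))).trans (le_of_eq ?_)
  rw [← pow_mul, ← pow_mul, mul_comm n (d + 1)]
  push_cast
  ring

omit [FiniteDimensional ℝ 𝔸] in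
/-- ★★ **(H2) AT A CORNER-TREE-READING FAMILY**: same data, `η ≥ 0`: for every bond function `a`, fine bond `f` and index bond `ι` over a window bond of
`rel 0 f₋` in the direction of `f`: `‖(−i)·LⁿQ_n(U₀)(iη·a♯)(ι) − ηLⁿ·(Q(U)a)(ι)‖ ≤ 2(d+1)·K₁·α·Lⁿ·η·‖a‖` — F2's row theorem, the flat row decomposition
(`linQIter_eq_sum_bondsIn`) of the rotated lift `(R(qT ι ·)a)♯`, c2-I's dictionary `LⁿQ_n(1)(a′♯)(ι) = Lⁿ·Σ_f qK ι f·a′(f)` and `Q(U) = trLiftY qK (qT U)`.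
[cite: Balaban1985Averaging, (141)–(147) pp.39–40, (125) p.36, (127) p.37; Balaban1985BackgroundPropagators, (3.12) p.392, (3.16) p.393] -/
theorem H2_of_cornerTree (hD : ∀ x, i.D.lev x = n) (hk : i.k = n + 1)
    {α : ℝ} (hα : 0 < α) (hαQ : α ≤ alphaQ (d + 1) (ℓ + 1))
    {U₀ : LSite (d + 1) → Fin (d + 1) → 𝔸ˣ} (hU₀ : ∀ x κ, U₀ x κ ∈ unitaryUnits 𝔸)
    (hreg : Reg17 (ℓ + 1) n (fun _ => (Set.univ : Set (LSite (d + 1)))) α U₀)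
    (parB : BondParY 𝔸 i) (U : CfgY 𝔸 i)
    (hqT : ∀ (ι : IBondY i) (y : LSite (d + 1)) (μ κ : Fin (d + 1)) (t : Fin 2),
      ι.1.2.src = transl (0 : Site (PV d ℓ i.m i.K hd hL) (ι.1.1 : ℕ)) (winBase (ℓ + 1) n y κ t) →
      qT i parB U ι ⟨transl (0 : Site (PV d ℓ i.m i.K hd hL) 0) y, μ⟩ =
        hol U₀ (loK (ℓ + 1) n (winBase (ℓ + 1) n y κ t)) (treeWord (y - loK (ℓ + 1) n (winBase (ℓ + 1) n y κ t))))
    {η : ℝ} (hη : 0 ≤ η) (a : FBondY i → 𝔸) (f : FBondY i) (ι : IBondY i) (t : Fin 2)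
    (hsrc : ι.1.2.src = transl (0 : Site (PV d ℓ i.m i.K hd hL) (ι.1.1 : ℕ))
      (winBase (ℓ + 1) n (rel (0 : Site (PV d ℓ i.m i.K hd hL) 0) f.src) f.dir t))
    (hdir : ι.1.2.dir = f.dir) :
    ‖clsField (ℓ + 1) (fun m' => torusLamb (d := d + 1) m') η n n U₀ (liftBd i a)
        (winBase (ℓ + 1) n (rel (0 : Site (PV d ℓ i.m i.K hd hL) 0) f.src) f.dir t) f.dir -
      ((η * (((ℓ + 1 : ℕ) : ℝ)) ^ n : ℝ) : ℂ) • QY i parB U a ι‖ ≤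
      2 * ((d : ℝ) + 1) * (13344 * ((d : ℝ) + 1) * ((d : ℝ) + 2) ^ 2 * ((d : ℝ) + 5) * (((ℓ + 1 : ℕ) : ℝ)) ^ (d + 4)) * α *
        (((ℓ + 1 : ℕ) : ℝ)) ^ n * η * ‖a‖ := by
  classical
  have hℓ : 2 ≤ ℓ + 1 := hL.2
  have hL1 : 1 ≤ ℓ + 1 := by omega
  have hd1 : 1 ≤ d + 1 := by omega
  have hn : ((ι.1.1 : ℕ)) = n := ibondY_level_eq i hD hk ι
  obtain ⟨s₀, μ⟩ := f
  simp only at hsrc hdir ⊢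
  set y := rel (0 : Site (PV d ℓ i.m i.K hd hL) 0) s₀ with hy
  set w := winBase (ℓ + 1) n y μ t with hw
  set lo := loK (ℓ + 1) n w with hlo
  set S := bondsIn lo (bondHiK (ℓ + 1) n w μ) with hS
  set A := liftBd i a with hA
  set B := iEta η A with hB
  -- the rotated bond function and its lift
  set a' : FBondY i → 𝔸 := fun f' => R (qT i parB U ι f') (a f') with ha'
  set G := iEta η (liftBd i a') with hG
  have hna' : ∀ f', ‖a' f'‖ ≤ ‖a'‖ := fun f' => norm_le_pi_norm a' f'
  -- Step 1: the closed field is `(−i)` times the composite averaging of `B = iη·a♯`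
  have e1 : clsField (ℓ + 1) (fun m' => torusLamb (d := d + 1) m') η n n U₀ A w μ =
      (-Complex.I) • linCovIter (ℓ + 1) U₀ B n w μ := by
    simp [clsField, mem_torusLamb_iff, hB]
  -- Step 2: F2's row theorem for `B`
  have hBb : ∀ x ν, BondIn lo (bondHiK (ℓ + 1) n w μ) x ν → ‖B x ν‖ ≤ η * ‖a‖ := fun x ν _ =>
    norm_iEta_le hη (fun z κ => by rw [hA, liftBd_apply]; exact norm_le_pi_norm a _) x ν
  have hrow := norm_linCovIter_sub_sum_linQIter_rot_le hℓ hd1 hα hαQ hU₀ hreg w μ B (by positivity) hBb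
  -- Step 3: the flat sum of rotated bumps is the flat composite of `G = iη·(a′)♯`
  have hGb : ∀ x ν, ‖G x ν‖ ≤ η * ‖a'‖ := fun x ν =>
    norm_iEta_le hη (fun z κ => by rw [liftBd_apply]; exact hna' _) x ν
  have e3 : ∑ s ∈ S, linQIter (ℓ + 1) (bump s.1 s.2 (conjR (hol U₀ lo (treeWord (s.1 - lo))) (B s.1 s.2))) n w μ =
      linQIter (ℓ + 1) G n w μ := by
    rw [linQIter_eq_sum_bondsIn (ℓ + 1) hL1 G (by positivity) hGb n w μ]
    refine Finset.sum_congr rfl fun s hs => ?_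
    have hin : InBox lo (bondHiK (ℓ + 1) n w μ) s.1 := (mem_bondsIn.1 hs).1
    obtain ⟨t', ht'⟩ := exists_winBase_of_inBox (ℓ + 1) hL1 hin
    have hq : qT i parB U ι ⟨transl (0 : Site (PV d ℓ i.m i.K hd hL) 0) s.1, s.2⟩ = hol U₀ lo (treeWord (s.1 - lo)) := by
      have h := hqT ι s.1 s.2 μ t' (by rw [← ht']; exact hsrc)
      rw [← ht'] at h
      exact h
    have hGs : G s.1 s.2 = conjR (hol U₀ lo (treeWord (s.1 - lo))) (B s.1 s.2) := by
      simp only [hG, hB, hA, iEta, liftBd_apply, ha', conjR_eq_R, R_smul, hq]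
    rw [hGs]
  -- Step 4: c2-I at the rotated bond function: `LⁿQ_n(1)(iη·(a′)♯)(ι) = iηLⁿ·Σ_f qK ι f·a′(f) = iηLⁿ·(Q(U)a)(ι)`
  have e4 : linQIter (ℓ + 1) G n w μ = ((Complex.I * η) * ((((ℓ + 1 : ℕ) : ℝ)) ^ n : ℝ)) • QY i parB U a ι := by
    have hGdef : G = (Complex.I * (η : ℂ)) • liftBd i a' := by
      funext x ν; simp [hG, iEta]
    have hfl := linQIter_liftBd_eq_sum_qK i ι w hsrc.symm a'
    rw [hdir] at hfl
    rw [hn] at hfl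
    have hQY : QY i parB U a ι = ∑ f', ((qK i ι f' : ℝ) : ℂ) • a' f' := by rw [QY, trLiftY_apply]
    rw [hGdef, linQIter_csmul, hfl, hQY, smul_smul]
  -- Step 5: assemble
  have hsc : (-Complex.I) * ((Complex.I * η) * ((((ℓ + 1 : ℕ) : ℝ)) ^ n : ℝ)) = ((η * (((ℓ + 1 : ℕ) : ℝ)) ^ n : ℝ) : ℂ) := by
    have hI : -Complex.I * (Complex.I * (η : ℂ)) = η := by
      rw [← mul_assoc, neg_mul, Complex.I_mul_I, neg_neg, one_mul]
    push_cast
    rw [← mul_assoc, hI]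
  rw [e1, show ((η * (((ℓ + 1 : ℕ) : ℝ)) ^ n : ℝ) : ℂ) • QY i parB U a ι =
      (-Complex.I) • ∑ s ∈ S, linQIter (ℓ + 1) (bump s.1 s.2 (conjR (hol U₀ lo (treeWord (s.1 - lo))) (B s.1 s.2))) n w μ by
    rw [e3, e4, smul_smul, hsc], ← smul_sub, norm_smul, norm_neg, Complex.norm_I, one_mul]
  refine (hrow.trans (row_bound_le (D := d + 1) (ℓ + 1) hL1 hα.le (by positivity) (by positivity))).trans (le_of_eq ?_)
  push_cast
  ring

/-- ★★★ **`hQQ` AT A CORNER-TREE-READING FAMILY, PER BACKGROUND.**  At a member of constant level `n` (nominal index `n + 1`, every site of level `n`,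
`b₀ = 1` band weights), for a faithful tracial `τ` with `|Re τ(x*y)| ≤ C_τ‖x‖‖y‖`, a unitary background `U₀ ∈ Reg17 L n ℤ^{d+1} α` with
`0 < α ≤ α_Q∕L²` (monotone in `α`: `reg17_mono`), and ANY transporter family `parB` and configuration `U` with unitary `qT parB U` reading the
corner-tree transport of `U₀` at the window pairs (`hqT`): for EVERY bond function `a`,
`|Q*(U)aQ(U)a − (c_fη)²·(QQZdP(U₀)a♯)♭|₍₋₃₎ ≤ ε_Q·|a|₍₋₁₎`, `ε_Q = (w₋₃∕w₋₁)·(c_fη)²·w_n·2(d+1)·C_τβ_τ·(6(d+1)·K₁·η·Lⁿ·LⁿL^{−n(d+1)}·α)`,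
`K₁ = 13344(d+1)(d+2)²(d+5)L^{d+4}` — file c7 fed with (H1)–(H3) above.
[cite: Balaban1985BackgroundPropagators, (3.16) p.393, (3.26) p.395, (3.41) p.397, (3.12) p.392; Balaban1985RegularSpaces, (1.58)–(1.59) p.86; Balaban1985Averaging, (139)–(147) pp.39–40] -/
theorem hQQ_of_cornerTree (hτp : ∀ a : 𝔸, a ≠ 0 → 0 < (τ (star a * a)).re) (hτt : ∀ a b : 𝔸, τ (a * b) = τ (b * a))
    {Cτ : ℝ} (hCτ : ∀ x y : 𝔸, |(τ (star x * y)).re| ≤ Cτ * ‖x‖ * ‖y‖)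
    (hD : ∀ x, i.D.lev x = n) (hk : i.k = n + 1) (hlev : ∀ z : SiteY i, levY i z = n)
    (hw : ∀ ι : IBondY i, i.w ι = i.cf ^ 2 * (((((ℓ + 1 : ℕ) : ℝ)) ^ (ι.1.1 : ℕ)) ^ (d + 1) * (1 / (((ℓ + 1 : ℕ) : ℝ)) ^ (ι.1.1 : ℕ)) ^ 2))
    (hL1 : 1 ≤ ℓ + 1) {η : ℝ} (hη : 0 < η) {k : ℕ} (hk1 : 1 ≤ k)
    {α : ℝ} (hα : 0 < α) (hαQ : α ≤ alphaQ (d + 1) (ℓ + 1) / ((ℓ + 1 : ℕ) : ℝ) ^ 2)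
    {U₀ : LSite (d + 1) → Fin (d + 1) → 𝔸ˣ} (hU₀ : ∀ x κ, U₀ x κ ∈ unitaryUnits 𝔸)
    (hreg : Reg17 (ℓ + 1) n (fun _ => (Set.univ : Set (LSite (d + 1)))) α U₀)
    (parB : BondParY 𝔸 i) (U : CfgY 𝔸 i) (hunit : ∀ (ι : IBondY i) (f : FBondY i), qT i parB U ι f ∈ unitaryUnits 𝔸)
    (hqT : ∀ (ι : IBondY i) (y : LSite (d + 1)) (μ κ : Fin (d + 1)) (t : Fin 2),
      ι.1.2.src = transl (0 : Site (PV d ℓ i.m i.K hd hL) (ι.1.1 : ℕ)) (winBase (ℓ + 1) n y κ t) →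
      qT i parB U ι ⟨transl (0 : Site (PV d ℓ i.m i.K hd hL) 0) y, μ⟩ =
        hol U₀ (loK (ℓ + 1) n (winBase (ℓ + 1) n y κ t)) (treeWord (y - loK (ℓ + 1) n (winBase (ℓ + 1) n y κ t))))
    (a : FBondY i → 𝔸) :
    wNormBY i (-3) (QsY i parB U (aY i (QY i parB U a)) -
        ((i.cf * η) ^ 2 : ℝ) • descBd i (QQZdP τ (ℓ + 1) (fun m' => torusLamb (d := d + 1) m') (torusIdx (d := d + 1) hL1 ⟨η, hη, k, hk1⟩) n
          U₀ (liftBd i a))) ≤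
      (weight (ℓ + 1) |i.cf|⁻¹ (-3) n / weight (ℓ + 1) |i.cf|⁻¹ (-1) n *
        ((i.cf * η) ^ 2 * wQ (d := d + 1) (ℓ + 1) η n *
          (2 * ((d : ℝ) + 1) * (Cτ * betaTau τ *
            (6 * ((d : ℝ) + 1) * (13344 * ((d : ℝ) + 1) * ((d : ℝ) + 2) ^ 2 * ((d : ℝ) + 5) * (((ℓ + 1 : ℕ) : ℝ)) ^ (d + 4)) * η *
              (((ℓ + 1 : ℕ) : ℝ)) ^ n * ((((ℓ + 1 : ℕ) : ℝ)) ^ n * (((((ℓ + 1 : ℕ) : ℝ)) ^ (d + 1)) ^ n)⁻¹) * α))))) * wNormBY i (-1) a := by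
  have hL0 : (1 : ℝ) ≤ ((ℓ + 1 : ℕ) : ℝ) := by exact_mod_cast hL1
  have hαQ' : α ≤ alphaQ (d + 1) (ℓ + 1) := by
    refine hαQ.trans (div_le_self (alphaQ_pos (d + 1) hL1).le ?_)
    exact one_le_pow₀ hL0
  have hreg' : Reg17 (ℓ + 1) n (fun _ => (Set.univ : Set (LSite (d + 1)))) (alphaQ (d + 1) (ℓ + 1) / ((ℓ + 1 : ℕ) : ℝ) ^ 2) U₀ :=
    reg17_mono hαQ hreg
  have h := hQQ_of_columns τ i hτp hτt hCτ hD hk hlev hw hL1 hη hk1 parB U hunit U₀ hreg' (by positivity) (by positivity)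
    (fun f ι κ t hsrc hdir X => H1_of_cornerTree i hD hk hα hαQ' hU₀ hreg parB U hqT f ι κ t hsrc hdir X)
    (fun a f ι t hsrc hdir => H2_of_cornerTree i hD hk hα hαQ' hU₀ hreg parB U hqT hη.le a f ι t hsrc hdir)
    (fun a f κ t => H3_of_reg17 i hα hαQ' hU₀ hreg hη.le a _ κ) a
  refine h.trans (le_of_eq ?_)
  ring

/-- ★★★ **`hQQ` AT THE CORNER-TREE FAMILY AND THE MEMBER's BACKGROUND.**  Same member and `τ`; for a unitary, `N₀`-periodic background `U₀ ∈ Reg17 L n ℤ^{d+1} α`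
(`0 < α ≤ α_Q∕L²`), def-Y's configuration `U = bgY i U₀` and the corner-tree transporter family `parBc_n` (§3): for EVERY bond function `a`,
`|Q*(U)aQ(U)a − (c_fη)²·(QQZdP(U₀)a♯)♭|₍₋₃₎ ≤ ε_Q·|a|₍₋₁₎` with the `ε_Q` of `hQQ_of_cornerTree` — the displayed averaging hypothesis `hQQ` of the torus socket
(`B9B8KnitTorusSocketBetaZero.sockB9P3Per_torusIdx_of_sectors₀`, last conjunct of `hY`) at `parB = parBc_n`, a fortiori for Hermitian `a`.
[cite: Balaban1985BackgroundPropagators, (3.12) p.392, (3.16) p.393, (3.26) p.395, (3.41) p.397; Balaban1985RegularSpaces, (1.58)–(1.59) p.86, p.77 («Ω_j = T_η»); Balaban1985Averaging, (139)–(147) pp.39–40] -/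
theorem hQQ_cornerTree_bgY (hτp : ∀ a : 𝔸, a ≠ 0 → 0 < (τ (star a * a)).re) (hτt : ∀ a b : 𝔸, τ (a * b) = τ (b * a))
    {Cτ : ℝ} (hCτ : ∀ x y : 𝔸, |(τ (star x * y)).re| ≤ Cτ * ‖x‖ * ‖y‖)
    (hD : ∀ x, i.D.lev x = n) (hk : i.k = n + 1) (hlev : ∀ z : SiteY i, levY i z = n)
    (hw : ∀ ι : IBondY i, i.w ι = i.cf ^ 2 * (((((ℓ + 1 : ℕ) : ℝ)) ^ (ι.1.1 : ℕ)) ^ (d + 1) * (1 / (((ℓ + 1 : ℕ) : ℝ)) ^ (ι.1.1 : ℕ)) ^ 2))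
    (hL1 : 1 ≤ ℓ + 1) {η : ℝ} (hη : 0 < η) {k : ℕ} (hk1 : 1 ≤ k)
    {α : ℝ} (hα : 0 < α) (hαQ : α ≤ alphaQ (d + 1) (ℓ + 1) / ((ℓ + 1 : ℕ) : ℝ) ^ 2)
    {U₀ : LSite (d + 1) → Fin (d + 1) → 𝔸ˣ} (hU₀ : ∀ x κ, U₀ x κ ∈ unitaryUnits 𝔸)
    (hper : IsPeriodic ((PV d ℓ i.m i.K hd hL).sitesPerDir 0) U₀)
    (hreg : Reg17 (ℓ + 1) n (fun _ => (Set.univ : Set (LSite (d + 1)))) α U₀) (a : FBondY i → 𝔸) :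
    wNormBY i (-3) (QsY i (fun (V : CfgY 𝔸 i) (s s' : Site (PV d ℓ i.m i.K hd hL) 0) =>
        hol (liftCfg V)
          (rel (0 : Site (PV d ℓ i.m i.K hd hL) 0) s' -
            fun ν => ((((s' ν - s ν + ((((ℓ + 1) ^ n - 1) / 2 : ℕ) : ZMod ((PV d ℓ i.m i.K hd hL).sitesPerDir 0))).val : ℕ) : ℤ)))
          (treeWord fun ν => ((((s' ν - s ν + ((((ℓ + 1) ^ n - 1) / 2 : ℕ) : ZMod ((PV d ℓ i.m i.K hd hL).sitesPerDir 0))).val : ℕ) : ℤ))))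
        (bgY i U₀) (aY i (QY i (fun (V : CfgY 𝔸 i) (s s' : Site (PV d ℓ i.m i.K hd hL) 0) =>
        hol (liftCfg V)
          (rel (0 : Site (PV d ℓ i.m i.K hd hL) 0) s' -
            fun ν => ((((s' ν - s ν + ((((ℓ + 1) ^ n - 1) / 2 : ℕ) : ZMod ((PV d ℓ i.m i.K hd hL).sitesPerDir 0))).val : ℕ) : ℤ)))
          (treeWord fun ν => ((((s' ν - s ν + ((((ℓ + 1) ^ n - 1) / 2 : ℕ) : ZMod ((PV d ℓ i.m i.K hd hL).sitesPerDir 0))).val : ℕ) : ℤ))))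
        (bgY i U₀) a)) -
        ((i.cf * η) ^ 2 : ℝ) • descBd i (QQZdP τ (ℓ + 1) (fun m' => torusLamb (d := d + 1) m') (torusIdx (d := d + 1) hL1 ⟨η, hη, k, hk1⟩) n
          U₀ (liftBd i a))) ≤
      (weight (ℓ + 1) |i.cf|⁻¹ (-3) n / weight (ℓ + 1) |i.cf|⁻¹ (-1) n *
        ((i.cf * η) ^ 2 * wQ (d := d + 1) (ℓ + 1) η n *
          (2 * ((d : ℝ) + 1) * (Cτ * betaTau τ *
            (6 * ((d : ℝ) + 1) * (13344 * ((d : ℝ) + 1) * ((d : ℝ) + 2) ^ 2 * ((d : ℝ) + 5) * (((ℓ + 1 : ℕ) : ℝ)) ^ (d + 4)) * η *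
              (((ℓ + 1 : ℕ) : ℝ)) ^ n * ((((ℓ + 1 : ℕ) : ℝ)) ^ n * (((((ℓ + 1 : ℕ) : ℝ)) ^ (d + 1)) ^ n)⁻¹) * α))))) * wNormBY i (-1) a := by
  have hlift : liftCfg (bgY i U₀) = U₀ := liftCfg_bgY i fun μ => shiftCfg_eq_of_isPeriodic hper μ
  refine hQQ_of_cornerTree τ i hτp hτt hCτ hD hk hlev hw hL1 hη hk1 hα hαQ hU₀ hreg _ (bgY i U₀)
    (fun ι f => qT_cornerTree_mem i (G := unitaryUnits 𝔸) (bgY_mem i hU₀) ι f) (fun ι y μ κ t hsrc => ?_) a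
  rw [qT_cornerTree_eq i (bgY i U₀) ι (ibondY_level_eq i hD hk ι) y μ κ t hsrc, hlift]

end Junction

/-! ## §5 Exact re-basing invariance of the sandwich `Q*(U)aQ(U)`

def-Y's averaging sandwich does not see an index-bond-wise re-basing of the block transporters: if two transporter families differ by a
rotation depending on the index bond only, `qT′ ι f = T_ι·qT ι f`, then `Q*′(U)aQ′(U) = Q*(U)aQ(U)` exactly (`a` is diagonal, `aY_apply`;
`R(T_ι qT)⁻¹ ∘ R(T_ι) ∘ R(qT) = R(qT)⁻¹ … `).  (The corner-tree family and print's centre-taxi family `parBY` differ by `T_ι(f) = U(Γ^{tree}_{x₀→f₋})·U(Γ^{taxi}_{ctr→f₋})⁻¹`,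
which depends on `f` through an `O(α)` plaquette product only — the optional file F4.) -/

section Rebase

variable {𝔸 : Type} [NormedRing 𝔸] [NormedAlgebra ℂ 𝔸] [CompleteSpace 𝔸] (i : KIdx d ℓ hd hL b₀ b₁)

omit [NormedAlgebra ℂ 𝔸] [CompleteSpace 𝔸] in
/-- `R(T)` is additive over finite sums. [cite: Balaban1985BackgroundPropagators, (3.12) p.392, bookkeeping] -/
private theorem R_finset_sum {X : Type*} (s : Finset X) (T : 𝔸ˣ) (F : X → 𝔸) : R T (∑ x ∈ s, F x) = ∑ x ∈ s, R T (F x) :=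
  map_sum (AddMonoidHom.mk' (R T) (R_add T)) F s

/-- ★★ **EXACT RE-BASING INVARIANCE OF `Q*(U)aQ(U)`**: if `qT parB′ U ι f = T ι · qT parB U ι f` for a rotation `T ι` depending on the index bond only, then
`Q*(parB′,U) a Q(parB′,U) = Q*(parB,U) a Q(parB,U)` on every bond function — the base point of the block contours in (3.12) is immaterial for (3.16).
[cite: Balaban1985BackgroundPropagators, (3.12)–(3.13) pp.392–393, (3.16) p.393, (3.26) p.395] -/
theorem QsY_aY_QY_rebase (parB parB' : BondParY 𝔸 i) (U : CfgY 𝔸 i) (T : IBondY i → 𝔸ˣ)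
    (hT : ∀ (ι : IBondY i) (f : FBondY i), qT i parB' U ι f = T ι * qT i parB U ι f) (a : FBondY i → 𝔸) :
    QsY i parB' U (aY i (QY i parB' U a)) = QsY i parB U (aY i (QY i parB U a)) := by
  funext f
  rw [QsY_apply, QsY_apply]
  refine Finset.sum_congr rfl fun ι _ => ?_
  rw [aY_apply, aY_apply]
  have hQ : QY i parB' U a ι = R (T ι) (QY i parB U a ι) := by
    rw [QY, QY, trLiftY_apply, trLiftY_apply, R_finset_sum]
    refine Finset.sum_congr rfl fun f' _ => ?_
    rw [hT, B9Eq39Adjoint.R_mul, R_smul]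
  rw [hQ, show (((i.w ι : ℝ)) : ℂ) • R (T ι) (QY i parB U a ι) = R (T ι) ((((i.w ι : ℝ)) : ℂ) • QY i parB U a ι) from (R_smul _ _ _).symm,
    hT ι f, mul_inv_rev, B9Eq39Adjoint.R_mul, R_inv_R]

end Rebase

end Literature.MathematicalPhysics.QuantumFieldTheory.Balaban1983to89.B9B8KnitAveragingClosenessAtCorner
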